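import Summits.QuantumFields.BalabanUV.T4Continuum.Support.ScalarAveragedPropagator
import Literature.MathematicalPhysics.QuantumFieldTheory.Balaban1983to89.B5G183FreeRowSum
import Literature.MathematicalPhysics.QuantumFieldTheory.Balaban1983to89.B5LaplaceInverse

/-!
# Row G-an2-4 ∕ (CONV-C), scalar currency — THE FREE MASSIVE RESOLVENT `F = (Δ + 1)⁻¹` OF THE SCALAR FINE-TORUS LAPLACIAN:
# Fourier form, positivity (discrete maximum principle), and the RESOLVENT IDENTITY `G′ = P_N − a′·P_N Π′ G′ + F^N G′` for NE2's
# `G′ = Gps = (Δ + a′Π′)⁻¹`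

NOT IN PRINT; OUR BOOKKEEPING.  Cell `pub-balaban`, G-an2-4 crux team (coordinator ruling e34b3e0c (2)), seat
`b2b-balaban-gan24-formalise-leaf-01` (gen 55), item «(s0) ∕ (K₀ˢ)» of the journal (`CLAIMS.log` l.28883 ∕ l.28893 ∕ l.28904 ∕ l.28990):
the zeroth-order, `n`-uniform, volume-uniform `ℓ^∞` block bound with exponential decay for NE2's LITERAL scalar averaged propagator
`T4Continuum.ScalarAveragedPropagator.Gps n M a′ = (LapS + a′•PiS)⁻¹` on `Tor (fine n M)`.  THIS FILE (module 1 of the line) is the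
scalar port of pv15's `B5G183FreeRowSum` §1–§2 for the SCALAR Laplacian `Δ = B5Action121.LapS (fine n M) n` plus the algebra of the
route: with `F = (Δ + 1)⁻¹`, `P_N = Σ_{k<N} F^{k+1}`, and `Δ′ = Δ + a′Π′`, `F⁻¹ − Δ′ = 1 − a′Π′` gives
`G′ = P_N − a′·P_N·Π′·G′ + F^N·G′` (proved by induction on `N` from `Δ′G′ = 1`, `F(Δ+1) = 1`).

WHAT IS PROVED (kernel; any `d`, any `n ≥ 1`, any torus; `Fin (d+1)` index bookkeeping as in pv15 ∕ `…-leaf-04`'s FILE 3):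
 * §1 (any torus `N`): `lsym` is real `≥ 0`; `Δ + 1 = Uᴴ diag(Δ(p)+1) U`, **`LapSOne_inv_eq`** `(Δ+1)⁻¹ = Uᴴ diag((Δ(p)+1)⁻¹) U`,
   `LapSOne_mul_inv`, `LapSOne_inv_mul`, **`LapSOne_inv_pow_eq`** (powers), `norm_chi`, `norm_dft`, **`norm_sandwich_apply_le`**
   (`|(Uᴴ diag(m) U)(x,x′)| ≤ |T|⁻¹ Σ_p |m(p)|`);
 * §2 `LapSOne_mulVec` (position form `((Δ+1)u)(x) = u(x) + n²Σ_ν[(u(x) − u(x+e_ν)) + (u(x) − u(x−e_ν))]`), and by pv15's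
   `min_principle` BY NAME: `im_inv_mulVec_ofReal`, `re_inv_mulVec_ofReal_nonneg`, `re_inv_mulVec_ofReal_mono` (`F` is real, positivity
   preserving, monotone), `inv_pow_mulVec_ofReal`, `inv_pow_apply_im_re` ∕ `norm_inv_pow_apply` (entries of `F^k` real `≥ 0`);
 * §3 `Gps_eq_step` and **`Gps_eq_resolvent_expansion`**: `Gps n M a′ = P_N − a′•(P_N * PiS * Gps) + F^N * Gps` for every `N`, every
   `a′ > 0` (`P_N = Σ_{k<N} F^{k+1}`).
The weights, block rows and the assembly are in the sequel modules `ScalarFreeResolventRows`, `ScalarFreeResolventDiagonal`, `ScalarSup110G`.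

HONEST SCOPE.  [folklore] finite-dimensional linear algebra and a discrete maximum principle for the cell's typed `U = 1` objects;
statements and constants OURS; nothing printed by Bałaban is used or asserted ([B5] (1.110) is printed for the VECTOR `G`; the scalar
block bound is [B9] (3.42)-type folklore — located, not quoted).  Method = pv15's (`B5G183FreeRowSum`, Hislop–Sigal Agmon-weight
reading), re-typed for 0-forms.  No `def`, no `def … : Prop`, no `sorry`.  NOT (CONV-C), NEVER «G-an2-4 closed», NOT NE2 ∕ NE3, NOT D1,
NOT BetaPertH, NOT the continuum limit, NOT Clay.  HONEST DEPENDENCY: continuum YM on T⁴ ⇐ BetaPertH ∧ nine spine estimates (0/9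
proved); BetaPertH ⇐ (D1) ∧ (D4) ∧ CAP+tail; G-an2-4 gates asym, D1 and NE2/3/4.
-/

noncomputable section

open scoped BigOperators ComplexConjugate Matrix
open Finset Complex Matrix

namespace Summit.QuantumFields.BalabanUV.Beta.GAN24.ScalarFreeResolvent

open Literature.MathematicalPhysics.QuantumFieldTheory.Balaban1983to89
open B5Prop11Plancherel (Tor fine unitVec chi dft)
open B5Action121 (LapS LapS_mulVec)
open B5LaplaceInverse (ssym lsym LapS_eq sandwich_mul one_eq_sandwich sandwich_congr dft_mul_conjTranspose
  dft_conjTranspose_mul)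
open B5Block118 (bpt)
open B6LowerBound2153Torus (toT)
open B4TorusKernel.MultiPeriod (circAbs torusSupNorm)
open B5G183FreeRowSum (min_principle weight_stencil weight_centre weight_block_lower single_le_prod_of_one_le)
open Summit.QuantumFields.BalabanUV.T4Continuum.ScalarBlockPoincare (PiS)
open Summit.QuantumFields.BalabanUV.T4Continuum.ScalarAveragedPropagator (DeltaPs Gps DeltaPs_mul_Gps Gps_mul_DeltaPs)

variable {d : ℕ}

/-! ## §1 Fourier form of `Δ + 1`, its inverse and powers; the sandwich entry bound -/

section Fourier

variable (N : Fin d → ℕ) [hN : ∀ μ, NeZero (N μ)] (c : ℂ)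

/-- the Laplacian symbol `Δ(p) = Σ_ν |∂_ν(p)|²` is real and nonnegative. [folklore] -/
theorem lsym_im_re (p : Tor N) : (lsym N c p).im = 0 ∧ 0 ≤ (lsym N c p).re := by
  unfold lsym
  refine ⟨?_, ?_⟩
  · rw [Complex.im_sum]
    exact Finset.sum_eq_zero fun ν _ => by rw [← Complex.normSq_eq_conj_mul_self, Complex.ofReal_im]
  · rw [Complex.re_sum]
    exact Finset.sum_nonneg fun ν _ => by rw [← Complex.normSq_eq_conj_mul_self, Complex.ofReal_re]; exact Complex.normSq_nonneg _

/-- `Δ(p) + 1 ≠ 0`. [folklore] -/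
theorem lsym_add_one_ne_zero (p : Tor N) : lsym N c p + 1 ≠ 0 := by
  intro h
  have h1 := congrArg Complex.re h
  rw [Complex.add_re, Complex.one_re, Complex.zero_re] at h1
  linarith [(lsym_im_re N c p).2]

/-- `Δ + 1 = Uᴴ diag(Δ(p) + 1) U`. [folklore] -/
theorem LapSOne_eq : LapS N c + 1 = (dft N)ᴴ * Matrix.diagonal (fun p => lsym N c p + 1) * dft N := by
  conv_lhs => rw [LapS_eq N c, one_eq_sandwich N]
  rw [← Matrix.add_mul, ← Matrix.mul_add, Matrix.diagonal_add]

/-- `(Δ + 1)·Uᴴ diag((Δ(p)+1)⁻¹) U = 1`. [folklore] -/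
theorem LapSOne_mul_sandwich : (LapS N c + 1) * ((dft N)ᴴ * Matrix.diagonal (fun p => (lsym N c p + 1)⁻¹) * dft N) = 1 := by
  rw [LapSOne_eq, sandwich_mul, one_eq_sandwich]
  exact sandwich_congr N fun p => mul_inv_cancel₀ (lsym_add_one_ne_zero N c p)

/-- **`(Δ + 1)⁻¹ = Uᴴ diag((Δ(p)+1)⁻¹) U`**. [folklore] -/
theorem LapSOne_inv_eq : (LapS N c + 1)⁻¹ = (dft N)ᴴ * Matrix.diagonal (fun p => (lsym N c p + 1)⁻¹) * dft N :=
  Matrix.inv_eq_right_inv (LapSOne_mul_sandwich N c)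

/-- `(Δ + 1)(Δ + 1)⁻¹ = 1`. [folklore] -/
theorem LapSOne_mul_inv : (LapS N c + 1) * (LapS N c + 1)⁻¹ = 1 := by
  rw [LapSOne_inv_eq]; exact LapSOne_mul_sandwich N c

/-- `(Δ + 1)⁻¹(Δ + 1) = 1`. [folklore] -/
theorem LapSOne_inv_mul : (LapS N c + 1)⁻¹ * (LapS N c + 1) = 1 := by
  rw [LapSOne_inv_eq, LapSOne_eq, sandwich_mul, one_eq_sandwich]
  exact sandwich_congr N fun p => inv_mul_cancel₀ (lsym_add_one_ne_zero N c p)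

/-- **powers**: `((Δ + 1)⁻¹)^k = Uᴴ diag((Δ(p)+1)^{−k}) U`. [folklore] -/
theorem LapSOne_inv_pow_eq (k : ℕ) :
    ((LapS N c + 1)⁻¹) ^ k = (dft N)ᴴ * Matrix.diagonal (fun p => ((lsym N c p + 1)⁻¹) ^ k) * dft N := by
  induction k with
  | zero => simp only [pow_zero]; exact one_eq_sandwich N
  | succ k ih =>
      rw [pow_succ, ih, LapSOne_inv_eq, sandwich_mul]
      exact sandwich_congr N fun p => by rw [pow_succ]

/-- `|e^{ip·x}| = 1`. [folklore] -/
theorem norm_chi (p x : Tor N) : ‖chi N p x‖ = 1 := by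
  unfold chi
  rw [norm_prod]
  exact Finset.prod_eq_one fun μ _ => Circle.norm_coe _

/-- `|U(p,x)| = |T|^{−1/2}`. [folklore] -/
theorem norm_dft (p x : Tor N) : ‖dft N p x‖ = (Real.sqrt (Fintype.card (Tor N)))⁻¹ := by
  unfold dft
  rw [norm_mul, Complex.norm_real, Real.norm_eq_abs, abs_of_nonneg (inv_nonneg.mpr (Real.sqrt_nonneg _)), Complex.norm_conj,
    norm_chi, mul_one]

/-- **the sandwich entry bound**: `|(Uᴴ diag(m) U)(x, x′)| ≤ |T|⁻¹ Σ_p |m(p)|`. [folklore] -/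
theorem norm_sandwich_apply_le (m : Tor N → ℂ) (x x' : Tor N) :
    ‖((dft N)ᴴ * Matrix.diagonal m * dft N) x x'‖ ≤ (Fintype.card (Tor N) : ℝ)⁻¹ * ∑ p, ‖m p‖ := by
  have hc : (0 : ℝ) ≤ Fintype.card (Tor N) := Nat.cast_nonneg _
  rw [Matrix.mul_apply, Finset.mul_sum]
  refine (norm_sum_le _ _).trans (Finset.sum_le_sum fun p _ => ?_)
  rw [Matrix.mul_diagonal, Matrix.conjTranspose_apply, norm_mul, norm_mul, norm_star, norm_dft, norm_dft]
  have e : (Real.sqrt (Fintype.card (Tor N)))⁻¹ * ‖m p‖ * (Real.sqrt (Fintype.card (Tor N)))⁻¹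
      = ((Real.sqrt (Fintype.card (Tor N)))⁻¹ * (Real.sqrt (Fintype.card (Tor N)))⁻¹) * ‖m p‖ := by ring
  rw [e, ← mul_inv, Real.mul_self_sqrt hc]

end Fourier

/-! ## §2 Position form of `Δ + 1`; the resolvent is real, positivity preserving, monotone -/

section Position

variable (n : ℕ) [NeZero n] (M : Fin (d + 1) → ℕ) [hM : ∀ μ, NeZero (M μ)]

/-- POSITION-SPACE FORM of `Δ + 1` for the scalar fine Laplacian (`B5Action121.LapS`, lattice factor `n = η⁻¹`):
`((Δ + 1)u)(x) = u(x) + n² Σ_ν [(u(x) − u(x + e_ν)) + (u(x) − u(x − e_ν))]`. [folklore] -/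
theorem LapSOne_mulVec (u : Tor (fine n M) → ℂ) (x : Tor (fine n M)) :
    ((LapS (fine n M) (n : ℂ) + 1) *ᵥ u) x
      = u x + (n : ℂ) ^ 2 * ∑ ν, ((u x - u (x + unitVec (fine n M) ν)) + (u x - u (x - unitVec (fine n M) ν))) := by
  rw [Matrix.add_mulVec, Matrix.one_mulVec, Pi.add_apply, add_comm, LapS_mulVec, Finset.mul_sum]
  congr 1
  refine Finset.sum_congr rfl fun ν _ => ?_
  rw [map_natCast]
  ring

/-- its real part. [folklore] -/
theorem re_LapSOne_mulVec (u : Tor (fine n M) → ℂ) (x : Tor (fine n M)) :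
    (((LapS (fine n M) (n : ℂ) + 1) *ᵥ u) x).re
      = (u x).re + (n : ℝ) ^ 2 * ∑ ν, (((u x).re - (u (x + unitVec (fine n M) ν)).re)
          + ((u x).re - (u (x - unitVec (fine n M) ν)).re)) := by
  rw [LapSOne_mulVec, show ((n : ℂ)) ^ 2 = (((n : ℝ) ^ 2 : ℝ) : ℂ) by push_cast; ring, Complex.add_re,
    Complex.re_ofReal_mul, Complex.re_sum]
  simp only [Complex.add_re, Complex.sub_re]

/-- its imaginary part. [folklore] -/
theorem im_LapSOne_mulVec (u : Tor (fine n M) → ℂ) (x : Tor (fine n M)) :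
    (((LapS (fine n M) (n : ℂ) + 1) *ᵥ u) x).im
      = (u x).im + (n : ℝ) ^ 2 * ∑ ν, (((u x).im - (u (x + unitVec (fine n M) ν)).im)
          + ((u x).im - (u (x - unitVec (fine n M) ν)).im)) := by
  rw [LapSOne_mulVec, show ((n : ℂ)) ^ 2 = (((n : ℝ) ^ 2 : ℝ) : ℂ) by push_cast; ring, Complex.add_im,
    Complex.im_ofReal_mul, Complex.im_sum]
  simp only [Complex.add_im, Complex.sub_im]

/-- `(Δ + 1)⁻¹` maps REAL data to REAL vectors. [folklore] -/
theorem im_inv_mulVec_ofReal (g : Tor (fine n M) → ℝ) (x : Tor (fine n M)) :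
    (((LapS (fine n M) (n : ℂ) + 1)⁻¹ *ᵥ fun j => (g j : ℂ)) x).im = 0 := by
  set u := (LapS (fine n M) (n : ℂ) + 1)⁻¹ *ᵥ fun j => (g j : ℂ) with hu
  have hB : (LapS (fine n M) (n : ℂ) + 1) *ᵥ u = fun j => (g j : ℂ) := by
    rw [hu, Matrix.mulVec_mulVec, LapSOne_mul_inv, Matrix.one_mulVec]
  have key : ∀ x : Tor (fine n M), (u x).im + (n : ℝ) ^ 2 *
      ∑ ν, (((u x).im - (u (x + unitVec (fine n M) ν)).im) + ((u x).im - (u (x - unitVec (fine n M) ν)).im)) = 0 := by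
    intro x
    rw [← im_LapSOne_mulVec, hB]
    simp
  have h1 : ∀ x, 0 ≤ (u x).im :=
    min_principle (fun ν (x : Tor (fine n M)) => x + unitVec (fine n M) ν) (fun ν x => x - unitVec (fine n M) ν)
      (C := (n : ℝ) ^ 2) (by positivity) (fun x => (u x).im) (fun x => (key x).ge)
  have h2 : ∀ x, 0 ≤ -(u x).im := by
    refine min_principle (fun ν (x : Tor (fine n M)) => x + unitVec (fine n M) ν) (fun ν x => x - unitVec (fine n M) ν)
      (C := (n : ℝ) ^ 2) (by positivity) (fun x => -(u x).im) (fun x => ?_)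
    have e : ∑ ν, ((-(u x).im - -(u (x + unitVec (fine n M) ν)).im) + (-(u x).im - -(u (x - unitVec (fine n M) ν)).im))
        = -∑ ν, (((u x).im - (u (x + unitVec (fine n M) ν)).im) + ((u x).im - (u (x - unitVec (fine n M) ν)).im)) := by
      rw [← Finset.sum_neg_distrib]
      exact Finset.sum_congr rfl fun ν _ => by ring
    rw [e, mul_neg]
    linarith [key x]
  have := h2 x
  exact le_antisymm (by linarith) (h1 x)

/-- `(Δ + 1)⁻¹` maps NONNEGATIVE data to NONNEGATIVE vectors. [folklore] -/
theorem re_inv_mulVec_ofReal_nonneg (g : Tor (fine n M) → ℝ) (hg : ∀ j, 0 ≤ g j) (x : Tor (fine n M)) :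
    0 ≤ (((LapS (fine n M) (n : ℂ) + 1)⁻¹ *ᵥ fun j => (g j : ℂ)) x).re := by
  set u := (LapS (fine n M) (n : ℂ) + 1)⁻¹ *ᵥ fun j => (g j : ℂ) with hu
  have hB : (LapS (fine n M) (n : ℂ) + 1) *ᵥ u = fun j => (g j : ℂ) := by
    rw [hu, Matrix.mulVec_mulVec, LapSOne_mul_inv, Matrix.one_mulVec]
  have key : ∀ x : Tor (fine n M), (u x).re + (n : ℝ) ^ 2 *
      ∑ ν, (((u x).re - (u (x + unitVec (fine n M) ν)).re) + ((u x).re - (u (x - unitVec (fine n M) ν)).re)) = g x := by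
    intro x
    rw [← re_LapSOne_mulVec, hB]
    simp
  exact min_principle (fun ν (x : Tor (fine n M)) => x + unitVec (fine n M) ν) (fun ν x => x - unitVec (fine n M) ν)
    (C := (n : ℝ) ^ 2) (by positivity) (fun x => (u x).re) (fun x => by rw [key x]; exact hg x) x

/-- MONOTONICITY of `(Δ + 1)⁻¹` on real data. [folklore] -/
theorem re_inv_mulVec_ofReal_mono (g g' : Tor (fine n M) → ℝ) (hgg' : ∀ j, g j ≤ g' j) (x : Tor (fine n M)) :
    (((LapS (fine n M) (n : ℂ) + 1)⁻¹ *ᵥ fun j => (g j : ℂ)) x).re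
      ≤ (((LapS (fine n M) (n : ℂ) + 1)⁻¹ *ᵥ fun j => (g' j : ℂ)) x).re := by
  have h := re_inv_mulVec_ofReal_nonneg n M (fun j => g' j - g j) (fun j => sub_nonneg.mpr (hgg' j)) x
  have e : (fun j => ((g' j - g j : ℝ) : ℂ)) = (fun j => (g' j : ℂ)) - fun j => (g j : ℂ) := by
    funext j; push_cast; rfl
  rw [e, Matrix.mulVec_sub, Pi.sub_apply, Complex.sub_re] at h
  linarith

/-- every resolvent power maps NONNEGATIVE real data to NONNEGATIVE real vectors. [folklore] -/
theorem inv_pow_mulVec_ofReal (g : Tor (fine n M) → ℝ) (hg : ∀ j, 0 ≤ g j) (k : ℕ) (x : Tor (fine n M)) :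
    ((((LapS (fine n M) (n : ℂ) + 1)⁻¹) ^ k *ᵥ fun j => (g j : ℂ)) x).im = 0
      ∧ 0 ≤ ((((LapS (fine n M) (n : ℂ) + 1)⁻¹) ^ k *ᵥ fun j => (g j : ℂ)) x).re := by
  induction k generalizing x with
  | zero =>
      rw [pow_zero, Matrix.one_mulVec]
      exact ⟨Complex.ofReal_im _, by rw [Complex.ofReal_re]; exact hg x⟩
  | succ k ih =>
      have hUre : (((LapS (fine n M) (n : ℂ) + 1)⁻¹) ^ k *ᵥ fun j => (g j : ℂ))
          = fun j => (((((LapS (fine n M) (n : ℂ) + 1)⁻¹) ^ k *ᵥ fun j => (g j : ℂ)) j).re : ℂ) := by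
        funext j
        apply Complex.ext
        · simp
        · rw [Complex.ofReal_im]; exact (ih j).1
      rw [pow_succ', ← Matrix.mulVec_mulVec, hUre]
      exact ⟨im_inv_mulVec_ofReal n M _ x, re_inv_mulVec_ofReal_nonneg n M _ (fun j => (ih j).2) x⟩

/-- ENTRIES of `F^k` are REAL and NONNEGATIVE. [folklore] -/
theorem inv_pow_apply_im_re (k : ℕ) (x x' : Tor (fine n M)) :
    ((((LapS (fine n M) (n : ℂ) + 1)⁻¹) ^ k) x x').im = 0 ∧ 0 ≤ ((((LapS (fine n M) (n : ℂ) + 1)⁻¹) ^ k) x x').re := by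
  have e : (((LapS (fine n M) (n : ℂ) + 1)⁻¹) ^ k) x x'
      = ((((LapS (fine n M) (n : ℂ) + 1)⁻¹) ^ k) *ᵥ fun j => ((if j = x' then (1 : ℝ) else 0 : ℝ) : ℂ)) x := by
    have hs : (fun j : Tor (fine n M) => ((if j = x' then (1 : ℝ) else 0 : ℝ) : ℂ)) = Pi.single x' 1 := by
      funext j
      rw [Pi.single_apply]
      split_ifs <;> simp
    rw [hs, Matrix.mulVec_single_one]
    rfl
  rw [e]
  exact inv_pow_mulVec_ofReal n M (fun j => if j = x' then (1 : ℝ) else 0) (fun j => by split_ifs <;> norm_num) k x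

/-- hence `‖F^k(x,x′)‖ = Re F^k(x,x′)`. [folklore] -/
theorem norm_inv_pow_apply (k : ℕ) (x x' : Tor (fine n M)) :
    ‖(((LapS (fine n M) (n : ℂ) + 1)⁻¹) ^ k) x x'‖ = ((((LapS (fine n M) (n : ℂ) + 1)⁻¹) ^ k) x x').re := by
  obtain ⟨him, hre⟩ := inv_pow_apply_im_re n M k x x'
  have e : (((LapS (fine n M) (n : ℂ) + 1)⁻¹) ^ k) x x' = (((((LapS (fine n M) (n : ℂ) + 1)⁻¹) ^ k) x x').re : ℂ) :=
    Complex.ext (by simp) (by rw [Complex.ofReal_im]; exact him)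
  conv_lhs => rw [e]
  rw [Complex.norm_real, Real.norm_of_nonneg hre]

end Position

/-! ## §3 The resolvent identity for NE2's `G′ = Gps = (Δ + a′Π′)⁻¹` around `F = (Δ + 1)⁻¹` -/

section Identity

variable (n : ℕ) [NeZero n] (M : Fin (d + 1) → ℕ) [hM : ∀ μ, NeZero (M μ)] {a' : ℝ}

/-- ONE STEP: `G′ = F − a′·F·Π′·G′ + F·G′` (from `F⁻¹ − Δ′ = 1 − a′Π′`, `Δ′ = DeltaPs = Δ + a′Π′`). [folklore] -/
theorem Gps_eq_step (ha' : 0 < a') :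
    Gps n M a' = (LapS (fine n M) (n : ℂ) + 1)⁻¹ - (a' : ℂ) • ((LapS (fine n M) (n : ℂ) + 1)⁻¹ * PiS n M * Gps n M a')
      + (LapS (fine n M) (n : ℂ) + 1)⁻¹ * Gps n M a' := by
  set F := (LapS (fine n M) (n : ℂ) + 1)⁻¹ with hF
  -- `F·Δ′·G′ = F` and `F·Δ′ = 1 − F + a′FΠ′`
  have h1 : F * DeltaPs n M a' * Gps n M a' = F := by rw [Matrix.mul_assoc, DeltaPs_mul_Gps n M ha', Matrix.mul_one]
  have h2 : F * DeltaPs n M a' = 1 - F + (a' : ℂ) • (F * PiS n M) := by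
    have e : DeltaPs n M a' = (LapS (fine n M) (n : ℂ) + 1) - 1 + (a' : ℂ) • PiS n M := by
      rw [DeltaPs, add_sub_cancel_right]
    rw [e, Matrix.mul_add, Matrix.mul_sub, hF, LapSOne_inv_mul, Matrix.mul_one, Matrix.mul_smul]
  rw [h2, Matrix.add_mul, Matrix.sub_mul, Matrix.one_mul, Matrix.smul_mul] at h1
  -- h1 : G′ − F G′ + a′ (FΠ′) G′ = F
  have h3 : Gps n M a' - F * Gps n M a' + (a' : ℂ) • (F * PiS n M * Gps n M a') - F = 0 := by rw [h1, sub_self]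
  have h4 : Gps n M a' - (F - (a' : ℂ) • (F * PiS n M * Gps n M a') + F * Gps n M a') = 0 := by
    rw [← h3]; abel
  exact sub_eq_zero.mp h4

/-- **THE RESOLVENT EXPANSION**: for every `N`,
`G′ = P_N − a′·P_N·Π′·G′ + F^N·G′`, `P_N = Σ_{k<N} F^{k+1}`, `F = (Δ + 1)⁻¹`. [folklore] -/
theorem Gps_eq_resolvent_expansion (ha' : 0 < a') (Nn : ℕ) :
    Gps n M a' = (∑ k ∈ Finset.range Nn, ((LapS (fine n M) (n : ℂ) + 1)⁻¹) ^ (k + 1))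
      - (a' : ℂ) • ((∑ k ∈ Finset.range Nn, ((LapS (fine n M) (n : ℂ) + 1)⁻¹) ^ (k + 1)) * PiS n M * Gps n M a')
      + ((LapS (fine n M) (n : ℂ) + 1)⁻¹) ^ Nn * Gps n M a' := by
  induction Nn with
  | zero => simp
  | succ N ih =>
      set F := (LapS (fine n M) (n : ℂ) + 1)⁻¹ with hF
      -- substitute the one-step identity into the remainder `F^N G′`
      have hstep := Gps_eq_step n M ha'
      rw [← hF] at hstep
      have hrem : F ^ N * Gps n M a' = F ^ (N + 1) - (a' : ℂ) • (F ^ (N + 1) * PiS n M * Gps n M a')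
          + F ^ (N + 1) * Gps n M a' := by
        conv_lhs => rw [hstep]
        rw [Matrix.mul_add, Matrix.mul_sub, Matrix.mul_smul, pow_succ]
        simp only [Matrix.mul_assoc]
      rw [Finset.sum_range_succ, Matrix.add_mul, Matrix.add_mul, smul_add]
      conv_lhs => rw [ih, hrem]
      abel

end Identity

end Summit.QuantumFields.BalabanUV.Beta.GAN24.ScalarFreeResolvent

end
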